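/-
Copyright (c) 2026 the pub-hodgecm-mathlib formalisation cell (harness21).  Prover seat hodgecm-mathlib-F0P3a-p04 (g23), 2026-09-02: line LH7 (closer row `stub_PKtupleK2`,
h413 = stmt-HodgeConjecture-24833), leaf `Cruxes/H413/Lines/F0_P3c_PKtuplePaydown.lean` ED. 3 print organ O8a `stub_PKsaU2 : ∀ L, PKsaU2Shape L` — THE ASSEMBLY (6) of the
in-house road (F0P3a-p03 (g21) `CENSUS-O8a-PKsaU2`; deal «= (6) p04» 09:01:51Z).  THEOREMS ONLY (no definition, no instance, no notation, no named fact, no `sorry`).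
-/
import Summits.HodgeConjecture.HodgeConjecture.Theorems.F0P3cPKtupleSaU2LocalClasses     -- ★ p850734 (LH7-p02 (g3)): (5b)+(6′) `exists_forall_eq_mk_ofChar_of_exists_eq_ofChar`; brings ★ `F0P3cPKtupleHSideLetters` (`PKsaU2Shape`), ★ `F0P3GlobalPacketDiscrete`
import Summits.HodgeConjecture.HodgeConjecture.Theorems.F0P3cPKtupleSaU2LocalFix          -- ★ (LH7-p02 (g3)): (1)+(2) `forall_mem_image_inclPlaceAdelic_apply_eq_self_of_eq_mk_ofChar` (over ★ p850555, ★ p850597, ★ Dieudonné)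
import Literature.NumberTheory.Automorphic.AutomorphicKneserCharacter                     -- ★ p850740 (LH7-p04 (g3)): (3)+(4)+(5a) `UnitaryGroup.exists_eq_ofChar_of_subset_closure_of_commutator_mem` (Kneser saturation, normal form ★ p850717)
import Literature.NumberTheory.Automorphic.UnitaryGroupFiniteAdelicDenseOrbitCM               -- ★ p850646 (this seat): `denseRange_archPart_toAdelic_antidiagOne` (weak approximation at `∞` = `hWA`)
import Literature.NumberTheory.Automorphic.UnitaryGroupRankTwoStrongApproximation            -- ★ p850697∕p850725 (F0P3a-p03 (g21)): (M1) `cm_mem_topologicalClosure_of_det_eq_one` (strong approximation = `hdense`)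
import Literature.NumberTheory.Automorphic.UnitaryGroupAdelicDet                            -- ★ `adelicDet` (the determinant `U(J)(𝔸) →* U(1)(𝔸)`)
import HarnessLib

/-!
# O8a `PKsaU2Shape L` PROVED — an occurring family of `U(Φ₂)` that is one-dimensional at almost every finite place is `θ_v ∘ det` EVERYWHERE,
# for ONE automorphic character `θ` of `U(1)_{L∕L⁺}`

Cell `pub/hodgecm-mathlib` (D-0151), crux H413 = `stmt-HodgeConjecture-24833`, half A line LH7, leaf `Cruxes/H413/Lines/F0_P3c_PKtuplePaydown.lean` ED. 3, print organ O8a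
`stub_PKsaU2 : ∀ (L : Type) [Field L] [NumberField L] [IsCMField L], PKsaU2Shape L` ([PlatonovRapinchuk1994] §7.4 Thm. 7.12 ∕ [Kneser1966]; [Rogawski1990] §13.3
pp. 202–203).  THEOREMS ONLY (kernel lane; `--supports stmt-HodgeConjecture-24833 --as helper`).

THE ROAD (F0P3a-p03 (g21) `CENSUS-O8a-PKsaU2.F0P3ap03g21.md`, steps (1)–(6); every brick ★, typed 2026-09-02T08:4x–09:2xZ by F0P3a-p03 (g21), LH7-p04 (g3), LH7-p02 (g3),
F0P3a-p04 (g23)):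
* OCCURRENCE ⇒ `(P, σ, ι, hconst)`: ★ `cmOccursInDiscreteSpectrum_iff` (`Iff.rfl`); a CHARACTER PLACE `v₁` exists because `L⁺` has infinitely many finite places (the cofinite
  hypothesis is non-void).
* (1)+(2) ★ `F0P3cPKtupleSaU2LocalFix.forall_mem_image_inclPlaceAdelic_apply_eq_self_of_eq_mk_ofChar`: `ι_{v₁}(SU(Φ₂)(L⁺_{v₁}))` fixes EVERY vector of `P` (★ p850555 local
  character isotypy — all of `U(Φ₂)(L⁺_{v₁})` acts through `χ`; Dieudonné ★ `AdelicCharactersDetQuasiSplit.localPi_apply_eq_one` — `χ` kills `SU`; ★ p850597 — from `σ` to `P`).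
* (3)+(4)+(5a) ★ p850740 `UnitaryGroup.exists_eq_ofChar_of_subset_closure_of_commutator_mem`: with `N₀ := ker det` (closed normal, contains every commutator
  `g⁻¹ (1,b)⁻¹ g (1,b)`), `S₁ := ι_{v₁}(SU(Φ₂)(L⁺_{v₁}))`, `D := SU(Φ₂)(L⁺)`, STRONG APPROXIMATION `hdense` = ★ p850725 `cm_mem_topologicalClosure_of_det_eq_one` (`SU(Φ₂)(L⁺) · SU(Φ₂)(L⁺_{v₁})`
  dense in `SU(Φ₂)(𝔸)`, archimedean components INCLUDED) and WEAK APPROXIMATION AT `∞` `hWA` = ★ p850646 `denseRange_archPart_toAdelic_antidiagOne` — Kneser saturation in `L²`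
  (normal form ★ p850717) + Schur + «eigencharacters are automorphic» (★ p850645 ∕ p850565): `∃ ψ, P = ofChar ψ μ₂`.
* (5b)+(6′) ★ p850734 `exists_forall_eq_mk_ofChar_of_exists_eq_ofChar` (★ p850679 `ψ⁻¹ = θ ∘ det`; local classes everywhere).
* **`pkSaU2Shape_holds (L) : PKsaU2Shape L`** — the leaf's `stub_PKsaU2 := fun L _ _ _ => pkSaU2Shape_holds L` at its next edition.

HONEST LABEL: count-neutral until the registrar re-ties the leaf; HC_CM is proved only modulo the 7 printed citations (2 remaining named inputs: hLiu418 =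
stmt-HodgeConjecture-24832, h413 = stmt-HodgeConjecture-24833) until rung 0 closes.  This file PAYS the print letter O8a of the LH7 leaf in-house; it touches no registered skeleton.
-/

set_option linter.dupNamespace false
set_option autoImplicit false

noncomputable section

open MeasureTheory NumberField IsDedekindDomain Topology Filter
open Literature.NumberTheory.Automorphic Literature.NumberTheory.Automorphic.UnitaryGroup
open Summit.HodgeConjecture.HodgeConjecture.Cruxes.H413.F0P3cPKtupleHSideLetters
open Summit.HodgeConjecture.HodgeConjecture.Cruxes.H413.F0P3GlobalPacketDiscrete
open Summit.HodgeConjecture.HodgeConjecture.Cruxes.H413.F0P3cPKtupleSaU2LocalClasses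
open Summit.HodgeConjecture.HodgeConjecture.Cruxes.H413.F0P3cPKtupleSaU2LocalFix

namespace Summit.HodgeConjecture.HodgeConjecture.Cruxes.H413.F0P3cPKtupleSaU2

variable (L : Type) [Field L] [NumberField L] [IsCMField L]

/-- **O8a `PKsaU2Shape L` HOLDS** — «a family `π₂ = (π₂,v)_v` of classes of `U(Φ₂)(L⁺_v)` OCCURRING in the discrete spectrum of an automorphic measure `μ₂`, one-dimensional at
almost every finite place, is `⟦ℂ_{θ_v ∘ det}⟧` at EVERY finite place for ONE automorphic character `θ` of `U(1)_{L∕L⁺}`» — by strong approximation for the simply connected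
`SU(Φ₂) ≅ SL₂` (★ p850725, in-house), Kneser saturation in `L²` (★ p850740), weak approximation at `∞` (★ p850646), the local character isotypy and Dieudonné (★ LocalFix), and
«automorphic characters of `U(Φ₂)` factor through `det`» + local classes (★ p850734).  The in-house payment of the LH7 leaf's print organ `stub_PKsaU2`.
[cite: PlatonovRapinchuk1994, §7.4 Thm. 7.12 p. 427] [cite: Kneser1966, Hauptsatz] [cite: Rogawski1990, §13.3 pp. 202–203] -/
theorem pkSaU2Shape_holds : PKsaU2Shape L := by
  classical
  intro μ₂ _ π₂ hocc hcof
  -- topological instances of `U(Φ₂)(𝔸_{L⁺})` (the `cmDatum` model is definitionally the `adelicGroupData` model)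
  haveI : LocallyCompactSpace (adelicGroupData ↥(maximalRealSubfield L) L (IsCMField.complexConj L) 2
      (Matrix.of fun i j : Fin 2 => if i.val + j.val + 1 = 2 then (1 : L) else 0)).Adelic :=
    locallyCompactSpace_cmDatum_Adelic L 2 _
  haveI : SecondCountableTopology (adelicGroupData ↥(maximalRealSubfield L) L (IsCMField.complexConj L) 2
      (Matrix.of fun i j : Fin 2 => if i.val + j.val + 1 = 2 then (1 : L) else 0)).Adelic :=
    secondCountableTopology_cmDatum_Adelic L 2 _
  -- `L⁺` has infinitely many finite places (a prime of `𝓞 L⁺` above every rational prime), so the cofinite hypothesis has a witness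
  haveI : Infinite (HeightOneSpectrum (𝓞 ↥(maximalRealSubfield L))) := by
    have hinj : Function.Injective (algebraMap ℤ (𝓞 ↥(maximalRealSubfield L))) := (algebraMap ℤ (𝓞 ↥(maximalRealSubfield L))).injective_int
    have key : ∀ p : Nat.Primes, ∃ w : HeightOneSpectrum (𝓞 ↥(maximalRealSubfield L)),
        w.asIdeal.comap (algebraMap ℤ (𝓞 ↥(maximalRealSubfield L))) = Ideal.span {(p : ℤ)} := by
      intro p
      have hp : Prime (p : ℤ) := Nat.prime_iff_prime_int.mp p.2
      haveI : (Ideal.span {(p : ℤ)}).IsPrime := (Ideal.span_singleton_prime hp.ne_zero).mpr hp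
      obtain ⟨Q, -, hQ, hQp⟩ := Ideal.exists_ideal_over_prime_of_isIntegral
        (S := 𝓞 ↥(maximalRealSubfield L)) (Ideal.span {(p : ℤ)}) ⊥
        (by
          rw [← RingHom.ker_eq_comap_bot, (RingHom.injective_iff_ker_eq_bot _).mp hinj]
          exact bot_le)
      refine ⟨⟨Q, hQ, fun hQbot => hp.ne_zero ?_⟩, hQp⟩
      have hmem : (p : ℤ) ∈ Q.comap (algebraMap ℤ (𝓞 ↥(maximalRealSubfield L))) := by
        rw [hQp]
        exact Ideal.mem_span_singleton_self _
      rw [hQbot, Ideal.mem_comap, Ideal.mem_bot, map_eq_zero_iff _ hinj] at hmem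
      exact hmem
    choose f hf using key
    refine Infinite.of_injective f fun p q hpq => ?_
    have h := hf p
    rw [hpq, hf q, Ideal.span_singleton_eq_span_singleton, Int.associated_iff_natAbs,
      Int.natAbs_natCast, Int.natAbs_natCast] at h
    exact Subtype.ext h.symm
  -- OCCURRENCE: the realising `(P, σ, ι)` and the constituent description
  obtain ⟨P, W, _, _, σ, hirr, hsm, -, ⟨ι, hι⟩, hconst⟩ :=
    (cmOccursInDiscreteSpectrum_iff L 2 (Matrix.of fun i j : Fin 2 => if i.val + j.val + 1 = 2 then (1 : L) else 0) μ₂ π₂).1 hocc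
  -- a CHARACTER PLACE `v₁`, and a place `w₁ ∣ v₁` of `L`
  obtain ⟨v₁, χ', hχ', hv⟩ := hcof.exists
  obtain ⟨w₁⟩ : Nonempty (PlacesOver L v₁) := inferInstance
  -- (1)+(2): `S₁ := ι_{v₁}(SU(Φ₂)(L⁺_{v₁}))` fixes every vector of `P`
  have hfix := forall_mem_image_inclPlaceAdelic_apply_eq_self_of_eq_mk_ofChar π₂ P σ hirr hsm ι hι v₁ (hconst v₁) χ' hχ' hv
  -- the sockets of ★ p850740: `N₀ := ker det` (closed, normal, contains the commutators), `D ⊆ U(Φ₂)(L⁺)`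
  have hJ : (Matrix.of fun i j : Fin 2 => if i.val + j.val + 1 = 2 then (1 : L) else 0).det ≠ 0 := (isUnit_antidiagOne_det L 2).ne_zero
  -- the determinant, typed on the datum's adelic points
  obtain ⟨dA, hdA⟩ : ∃ dA : (adelicGroupData ↥(maximalRealSubfield L) L (IsCMField.complexConj L) 2 (Matrix.of fun i j : Fin 2 => if i.val + j.val + 1 = 2 then (1 : L) else 0)).Adelic →* ↥(adelicOne ↥(maximalRealSubfield L) L (IsCMField.complexConj L)),
      ∀ g : (adelicGroupData ↥(maximalRealSubfield L) L (IsCMField.complexConj L) 2 (Matrix.of fun i j : Fin 2 => if i.val + j.val + 1 = 2 then (1 : L) else 0)).Adelic, (((dA g : ↥(adelicOne ↥(maximalRealSubfield L) L (IsCMField.complexConj L))) : (AdeleRing (𝓞 L) L)ˣ) : AdeleRing (𝓞 L) L) =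
        ((g.1 : GL (Fin 2) (AdeleRing (𝓞 L) L)) : Matrix (Fin 2) (Fin 2) (AdeleRing (𝓞 L) L)).det :=
    ⟨adelicDet ↥(maximalRealSubfield L) L (IsCMField.complexConj L) 2 (Matrix.of fun i j : Fin 2 => if i.val + j.val + 1 = 2 then (1 : L) else 0) hJ,
      fun g => coe_coe_adelicDet ↥(maximalRealSubfield L) L (IsCMField.complexConj L) 2 (Matrix.of fun i j : Fin 2 => if i.val + j.val + 1 = 2 then (1 : L) else 0) hJ g⟩
  have hmemN₀ : ∀ g : (adelicGroupData ↥(maximalRealSubfield L) L (IsCMField.complexConj L) 2 (Matrix.of fun i j : Fin 2 => if i.val + j.val + 1 = 2 then (1 : L) else 0)).Adelic, g ∈ dA.ker ↔ ((g.1 : GL (Fin 2) (AdeleRing (𝓞 L) L)) : Matrix (Fin 2) (Fin 2) (AdeleRing (𝓞 L) L)).det = 1 := by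
    intro g
    rw [MonoidHom.mem_ker, ← hdA g, ← OneMemClass.coe_eq_one, Units.val_eq_one]
  have hN₀closed : IsClosed (dA.ker : Set (adelicGroupData ↥(maximalRealSubfield L) L (IsCMField.complexConj L) 2 (Matrix.of fun i j : Fin 2 => if i.val + j.val + 1 = 2 then (1 : L) else 0)).Adelic) := by
    haveI : T2Space (AdeleRing (𝓞 L) L) := inferInstanceAs <| T2Space (InfiniteAdeleRing L × FiniteAdeleRing (𝓞 L) L)
    have hset : (dA.ker : Set (adelicGroupData ↥(maximalRealSubfield L) L (IsCMField.complexConj L) 2 (Matrix.of fun i j : Fin 2 => if i.val + j.val + 1 = 2 then (1 : L) else 0)).Adelic) =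
        {g | ((g.1 : GL (Fin 2) (AdeleRing (𝓞 L) L)) : Matrix (Fin 2) (Fin 2) (AdeleRing (𝓞 L) L)).det = 1} := by
      ext g; exact hmemN₀ g
    rw [hset]
    refine isClosed_eq ?_ continuous_const
    exact (continuous_id.matrix_det).comp (Units.continuous_val.comp continuous_subtype_val)
  have hcomm : ∀ (b : finAdelic ↥(maximalRealSubfield L) L (IsCMField.complexConj L) 2 (Matrix.of fun i j : Fin 2 => if i.val + j.val + 1 = 2 then (1 : L) else 0)) (g : (adelicGroupData ↥(maximalRealSubfield L) L (IsCMField.complexConj L) 2 (Matrix.of fun i j : Fin 2 => if i.val + j.val + 1 = 2 then (1 : L) else 0)).Adelic),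
      g⁻¹ * (finAdelicToAdelic ↥(maximalRealSubfield L) L (IsCMField.complexConj L) 2 (Matrix.of fun i j : Fin 2 => if i.val + j.val + 1 = 2 then (1 : L) else 0) b)⁻¹ * g *
        finAdelicToAdelic ↥(maximalRealSubfield L) L (IsCMField.complexConj L) 2 (Matrix.of fun i j : Fin 2 => if i.val + j.val + 1 = 2 then (1 : L) else 0) b ∈ dA.ker := by
    intro b g
    rw [MonoidHom.mem_ker, map_mul, map_mul, map_mul, map_inv, map_inv, mul_right_comm _⁻¹, inv_mul_cancel, one_mul, inv_mul_cancel]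
  have hD : (toAdelic ↥(maximalRealSubfield L) L (IsCMField.complexConj L) 2 (Matrix.of fun i j : Fin 2 => if i.val + j.val + 1 = 2 then (1 : L) else 0) ''
      {γ : rational ↥(maximalRealSubfield L) L (IsCMField.complexConj L) 2 (Matrix.of fun i j : Fin 2 => if i.val + j.val + 1 = 2 then (1 : L) else 0) |
        ((γ : GL (Fin 2) L) : Matrix (Fin 2) (Fin 2) L).det = 1}) ⊆
      ((adelicGroupData ↥(maximalRealSubfield L) L (IsCMField.complexConj L) 2 (Matrix.of fun i j : Fin 2 => if i.val + j.val + 1 = 2 then (1 : L) else 0)).quotientSubgroup : Set (adelicGroupData ↥(maximalRealSubfield L) L (IsCMField.complexConj L) 2 (Matrix.of fun i j : Fin 2 => if i.val + j.val + 1 = 2 then (1 : L) else 0)).Adelic) := by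
    rintro _ ⟨γ, -, rfl⟩
    exact (adelicGroupData ↥(maximalRealSubfield L) L (IsCMField.complexConj L) 2 (Matrix.of fun i j : Fin 2 => if i.val + j.val + 1 = 2 then (1 : L) else 0)).arithmeticSubgroup_le_quotientSubgroup ⟨γ, rfl⟩
  -- STRONG APPROXIMATION (M1): `ker det ⊆ closure ⟨D ∪ S₁⟩`
  have hdense : (dA.ker : Set (adelicGroupData ↥(maximalRealSubfield L) L (IsCMField.complexConj L) 2 (Matrix.of fun i j : Fin 2 => if i.val + j.val + 1 = 2 then (1 : L) else 0)).Adelic) ⊆ closure ((Subgroup.closure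
      (toAdelic ↥(maximalRealSubfield L) L (IsCMField.complexConj L) 2 (Matrix.of fun i j : Fin 2 => if i.val + j.val + 1 = 2 then (1 : L) else 0) ''
          {γ : rational ↥(maximalRealSubfield L) L (IsCMField.complexConj L) 2 (Matrix.of fun i j : Fin 2 => if i.val + j.val + 1 = 2 then (1 : L) else 0) |
            ((γ : GL (Fin 2) L) : Matrix (Fin 2) (Fin 2) L).det = 1} ∪
        inclPlaceAdelic ↥(maximalRealSubfield L) L (IsCMField.complexConj L) 2 (Matrix.of fun i j : Fin 2 => if i.val + j.val + 1 = 2 then (1 : L) else 0) v₁ ''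
          {u : ↥(localPi L (IsCMField.complexConj L) 2 (Matrix.of fun i j : Fin 2 => if i.val + j.val + 1 = 2 then (1 : L) else 0) v₁) |
            ∀ w : PlacesOver L v₁, (((u : LocalGLPi L 2 v₁) w : GL (Fin 2) (w.1.adicCompletion L)) : Matrix (Fin 2) (Fin 2) (w.1.adicCompletion L)).det = 1}) :
      Subgroup (adelicGroupData ↥(maximalRealSubfield L) L (IsCMField.complexConj L) 2 (Matrix.of fun i j : Fin 2 => if i.val + j.val + 1 = 2 then (1 : L) else 0)).Adelic) : Set (adelicGroupData ↥(maximalRealSubfield L) L (IsCMField.complexConj L) 2 (Matrix.of fun i j : Fin 2 => if i.val + j.val + 1 = 2 then (1 : L) else 0)).Adelic) := by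
    intro s hs
    rw [← Subgroup.topologicalClosure_coe]
    exact cm_mem_topologicalClosure_of_det_eq_one L w₁ s ((hmemN₀ s).1 hs)
  -- (3)+(4)+(5a): Kneser saturation + weak approximation at `∞` ⇒ `P = ofChar ψ`
  have hψ := UnitaryGroup.exists_eq_ofChar_of_subset_closure_of_commutator_mem ↥(maximalRealSubfield L) L (IsCMField.complexConj L) 2 (Matrix.of fun i j : Fin 2 => if i.val + j.val + 1 = 2 then (1 : L) else 0) μ₂
    (denseRange_archPart_toAdelic_antidiagOne L 2) P dA.ker hN₀closed _ hD hdense hfix hcomm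
  -- (5b)+(6′)
  exact exists_forall_eq_mk_ofChar_of_exists_eq_ofChar π₂ P σ hirr ⟨ι, hι⟩ hconst hψ

end Summit.HodgeConjecture.HodgeConjecture.Cruxes.H413.F0P3cPKtupleSaU2

end
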